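import Summits.QuantumFields.YangMills.Theorems.PencilRigidityDiagonalMirrorRPRStubRpClosureOffDiag
import Summits.QuantumFields.YangMills.Theorems.PencilRigidityDiagonalMirrorRPRStubRpClosureTwistedLattice

/-!
# Crux `DiagonalMirrorRPR` (stmt-QuantumFields-10604), line `centre-twisted-swap`: the stub `stub_rpClosureTwisted`
# (S4'', the OS-limit closure from TWISTED cover reflection positivity, no sign clause)

The registered stub `stub_rpClosureTwisted` of the skeletons `Cruxes/DiagonalMirrorRPR/Lines/centre_twisted_swap.lean` and
`…/kms_variance_lukewarm_descent.lean` (same statement, namespace `…CentreTwistedSwap`): for a compact simple `G`, `r`, `sch`,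
`S₁` with the curvature package, if at every step with `side ≥ 2` the 45° cover is `Θ'_z`-reflection positive for SOME central
`z` (`CoverTwistedSwapRPAt r.ρ z (β_k) (side_k)` — for centre data this holds at every coupling: `z = 1` for `β ≥ 0` by the
landed S1 `stub_fortyFiveSwapRP`, `r.ρ z = −𝟙` for `β ≤ 0` by the landed S1' `stub_twistedSwapRP`), and cover insensitivity
holds on off-diagonal compact real families, then `S₁` is reflection positive in pull-back form in the four diagonal frames.

Proof: VERBATIM the landed S4' (`…StubRpClosureOffDiag`: `psd_canonical_offDiag` → `psd_frame_offDiag` →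
`isReflectionPositive_pullback_offDiag` → `stub_rpClosureOffDiag`, whose sign hypothesis was unused), with the single
lattice-positivity step replaced: the Gram observables `A k I = ∏_l Φ̃_k(f_{I,l} ∘ R⁻¹)` are products of smeared curvature
fields of the cover, hence blind to the centre twist (`RpClosureTwisted.coverField_centreTwist`, landed in
`…StubRpClosureTwistedLattice`), so the twisted hypothesis gives the plain Gram positivity
(`RpClosureTwisted.lattice_psd_twisted`, ibid., registered sub-goal `stub_rpClosureTwisted_latticePSD`) that the closure
consumes.  Chain here: `psd_canonical_twisted` → `psd_frame_twisted` → `isReflectionPositive_pullback_twisted` →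
`stub_rpClosureTwisted`.

References: Osterwalder–Schrader, Comm. Math. Phys. 31 (1973) §2–3; Glimm–Jaffe, *Quantum Physics* §6.1;
Fröhlich–Israel–Lieb–Simon, Comm. Math. Phys. 62 (1978) Thm 2.1; 't Hooft, Nucl. Phys. B153 (1979) 141;
Osterwalder–Seiler, Ann. Phys. 110 (1978) §2.
-/

set_option autoImplicit false

noncomputable section

open scoped SchwartzMap ComplexConjugate InnerProductSpace
open MeasureTheory Filter Topology
open Literature.MathematicalPhysics.QuantumLattice Literature.MathematicalPhysics.AQFT
  Literature.MathematicalPhysics.QuantumFieldTheory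

namespace Summit.QuantumFields.YangMills.Cruxes.DiagonalMirrorRPR.CentreTwistedSwap

open ParityBridgeColdTraces ParityBridgeColdTraces.RpClosure

/-! # Proof material (sub-namespace `RpClosureTwisted`, next to the landed lattice half) -/

namespace RpClosureTwisted

/-! ## §H'' Positivity of the limiting quadratic form, from twisted cover RP -/

section PSD

variable {G : Type} [Group G] [TopologicalSpace G] [IsTopologicalGroup G] [CompactSpace G]
  [MeasurableSpace G] [BorelSpace G] (r : LatticeRep G) (sch : SpeciesScheme (YMSpecies G))
  {R : E4 ≃ₗᵢ[ℝ] E4} {c : ℝ}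

/-- **(PSD) in a canonical frame, twisted cover RP.** For `R e₀ = c (e₀ − e₁)`, `c = 1/√2`, every finite family of
slab-ordered compact real products `P_I` and coefficients `c_I`: `∑_{I,J} c̄_I c_J 𝔖(R · (Θ P_I* ⊗ P_J)) ≥ 0`.  Same proof as
`psd_canonical_offDiag`; at each large step `k` a central `z_k` with `Θ'_{z_k}`-RP is chosen, and the Gram observables, being
products of smeared curvature fields of the cover, are `C_{z_k}`-blind, so `lattice_psd_twisted` applies. -/
theorem psd_canonical_twisted (S₁ : SchwingerFamily E4) (hW : CurvaturePackage r sch S₁)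
    (hRP : ∀ k, 2 ≤ sch.side k → ∃ z ∈ Subgroup.center G, CoverTwistedSwapRPAt r.ρ z (sch.β k) (sch.side k)) (hCI : CoverInsensitivityOffDiag r sch)
    (hc : c ^ 2 = 1 / 2) (hc0 : 0 < c) (hR : R (ee 0) = c • ee 0 + (-c) • ee 1) {ι : Type} [Fintype ι]
    (deg : ι → ℕ) (P : (I : ι) → 𝓢((Fin (deg I) → E4), ℂ))
    (hP : ∀ I, P I ∈ slabOrderedCompactProducts 4 (deg I)) (coef : ι → ℂ) :
    let z := ∑ I, ∑ J, conj (coef I) * coef J * (pullback S₁ R).osPairing (P I) (P J)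
    0 ≤ z.re ∧ z.im = 0 := by
  -- adapted from `psd_canonical_offDiag` (…StubRpClosureOffDiag §H'): only the last step (lattice positivity) changes
  intro z
  haveI : SecondCountableTopology G :=
    (r.continuous.isClosedEmbedding r.injective).isEmbedding.secondCountableTopology
  obtain ⟨hconv, ⟨hE0, -, -, -, -, -⟩, -, -, -⟩ := hW
  choose f lo hi hT hlo hle hord hsupp hcs using hP
  obtain ⟨ϱ, hϱ⟩ := exists_radius r.curvature.supp
  -- the lattice observables `A_I^k = ∏_l Φ̃_k(f_{I,l} ∘ R⁻¹)`
  let A : (k : ℕ) → ι → TConfig (2 * sch.side k) (sch.side k) (sch.side k) G → ℝ :=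
    fun k I U => ∏ l, coverField r sch k (linActTest R (f I l)) U
  have hAobs : ∀ k I, Measurable (A k I) ∧ ∃ C : ℝ, ∀ U, |A k I U| ≤ C := fun k I =>
    prod_observable _ (fun l => measurable_coverField r sch k _) fun l => exists_abs_coverField_le r sch k _
  -- eventually they live on the closed positive half
  have hAdep : ∀ᶠ k in atTop, ∀ I, DependsOn (A k I) (posEdges (sch.side k)) := by
    have hev : ∀ I (l : Fin (deg I)), ∀ᶠ k in atTop, sch.a k * (c * (2 * ϱ + 1)) < lo I l ∧
        hi I l < c * sch.a k * (2 * (sch.L k : ℝ) - 2 * ϱ - 1) := fun I l =>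
      (eventually_a_mul_lt sch _ (hlo I l)).and (eventually_lt_window sch hc0 ϱ (hi I l))
    have hev' : ∀ᶠ k in atTop, ∀ I (l : Fin (deg I)), sch.a k * (c * (2 * ϱ + 1)) < lo I l ∧
        hi I l < c * sch.a k * (2 * (sch.L k : ℝ) - 2 * ϱ - 1) :=
      Filter.eventually_all.2 fun I => Filter.eventually_all.2 fun l => hev I l
    filter_upwards [hev'] with k hk I
    refine dependsOn_prod _ fun l => ?_
    exact dependsOn_smearedLatticeField r.curvature hϱ _ _ _ _ _ fun x _ hne =>
      sheared_range_of_ne_zero hR hc0 (hsupp I l) (sch.a_pos k) (hk I l).1 (hk I l).2 x hne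
  -- the closed target set
  let C : Set ℂ := {w | 0 ≤ w.re ∧ w.im = 0}
  have hCcl : IsClosed C :=
    (isClosed_le continuous_const Complex.continuous_re).inter (isClosed_eq Complex.continuous_im continuous_const)
  -- entry convergence
  have hentry : ∀ I J, Tendsto (fun k => texp r.ρ (sch.β k) true
      (fun U => ((A k I (swapConfig U) * A k J U : ℝ) : ℂ))) atTop (𝓝 ((pullback S₁ R).osPairing (P I) (P J))) := by
    intro I J
    -- the real factors of `Θ P_I* ⊗ P_J` and their rotated versions
    let g : Fin (deg I + deg J) → 𝓢(E4, ℝ) := Fin.append (fun i => thetaTest 4 (f I (Fin.rev i))) (f J)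
    let gR : Fin (deg I + deg J) → 𝓢(E4, ℝ) := fun p => linActTest R (g p)
    have hTg : IsTensorOf ((osAdjoint (P I)).appendTensor (P J)) fun p => ofRealTest (g p) :=
      isTensorOf_osAdjoint_appendTensor (hT I) (hT J)
    have hTgR : IsTensorOf (linActMulti R ((osAdjoint (P I)).appendTensor (P J))) fun p => ofRealTest (gR p) :=
      hTg.linActMulti R
    obtain ⟨LO, HI, -, hord', hsupp'⟩ :=
      append_slabs (hlo I) (hle I) (hord I) (hsupp I) (hlo J) (hle J) (hord J) (hsupp J)
    have hoffR : IsOffDiagonal (linActMulti R ((osAdjoint (P I)).appendTensor (P J))) :=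
      isOffDiagonal_linActMulti (isOffDiagonal_of_slabs hTg hord' hsupp') R
    -- NEW: the rotated factors have pairwise disjoint supports
    have hdisjR : ∀ p q, p ≠ q → Disjoint (tsupport (gR p : E4 → ℝ)) (tsupport (gR q : E4 → ℝ)) :=
      fun p q hpq => disjoint_tsupport_linActTest_of_slabs hord' hsupp' R p q hpq
    have hcsg : ∀ p, HasCompactSupport (g p : E4 → ℝ) := fun p => by
      induction p using Fin.addCases with
      | left i => simp only [g, Fin.append_left]; exact hasCompactSupport_thetaTest (hcs I _)
      | right j => simp only [g, Fin.append_right]; exact hcs J j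
    have hcsR : ∀ p, HasCompactSupport (gR p : E4 → ℝ) := fun p => hasCompactSupport_linActTest (hcsg p) R
    -- the cover Gram entry is the cover Schwinger function of the rotated factors
    have hprod : ∀ k U, ∏ p, coverField r sch k (gR p) U = A k I (swapConfig U) * A k J U := by
      intro k U
      rw [Fin.prod_univ_add]
      simp only [gR, g, Fin.append_left, Fin.append_right, A]
      congr 1
      simp only [coverField_thetaTest r sch hR hc]
      exact Fintype.prod_equiv Fin.revPerm _ _ fun i => by simp
    have hident : ∀ k, texp r.ρ (sch.β k) true (fun U => ((A k I (swapConfig U) * A k J U : ℝ) : ℂ)) =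
        ((coverSchwinger r sch k (deg I + deg J) gR : ℝ) : ℂ) := by
      intro k
      rw [texp_ofReal_eq_re, coverSchwinger_eq]
      simp only [hprod]
    simp only [hident, pullback_osPairing]
    by_cases hn : deg I + deg J = 0
    · -- degree zero: both sides are `1`
      haveI : IsEmpty (Fin (deg I + deg J)) := by rw [hn]; infer_instance
      have hdI : deg I = 0 := by omega
      have hdJ : deg J = 0 := by omega
      haveI : IsEmpty (Fin (deg I)) := by rw [hdI]; infer_instance
      haveI : IsEmpty (Fin (deg J)) := by rw [hdJ]; infer_instance
      have hlim : S₁ (deg I + deg J) (linActMulti R ((osAdjoint (P I)).appendTensor (P J))) = 1 := by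
        have hgen : ∀ {m : ℕ} (hm : m = 0) (F : 𝓢((Fin m → E4), ℂ)) (x : Fin m → E4), S₁ m F = F x := by
          intro m hm F x
          subst hm
          exact (hE0 (fun _ => ()) F).trans (congrArg F (Subsingleton.elim _ _))
        rw [hgen hn _ (fun _ => 0), hTgR]
        simp
      have hcov : ∀ k, coverSchwinger r sch k (deg I + deg J) gR = 1 := fun k => by
        rw [coverSchwinger_eq]
        simp only [Finset.univ_eq_empty, Finset.prod_empty, Complex.ofReal_one]
        rw [texp_one r.ρ _ _ r.continuous, Complex.one_re]
      simp only [hlim, hcov, Complex.ofReal_one]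
      exact tendsto_const_nhds
    · have h1 := hconv (deg I + deg J) hn gR _ hTgR hoffR
      have h2 := hCI (deg I + deg J) hn gR hcsR hdisjR
      have h3 : Tendsto (fun k => ((latticeSchwinger r.ρ sch (fun s => s.F) k (deg I + deg J)
          (fun _ => r.curvature) gR : ℝ) : ℂ) - (((latticeSchwinger r.ρ sch (fun s => s.F) k (deg I + deg J)
          (fun _ => r.curvature) gR - coverSchwinger r sch k (deg I + deg J) gR : ℝ)) : ℂ)) atTop
          (𝓝 (S₁ (deg I + deg J) (linActMulti R ((osAdjoint (P I)).appendTensor (P J))) - ((0 : ℝ) : ℂ))) :=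
        h1.sub ((Complex.continuous_ofReal.tendsto 0).comp h2)
      simp only [Complex.ofReal_zero, sub_zero] at h3
      refine h3.congr fun k => ?_
      push_cast
      ring
  -- assembling: the lattice Gram forms converge to `z` and are eventually in `C`
  have hlim : Tendsto (fun k => ∑ I, ∑ J, conj (coef I) * coef J *
      texp r.ρ (sch.β k) true (fun U => ((A k I (swapConfig U) * A k J U : ℝ) : ℂ))) atTop (𝓝 z) :=
    tendsto_finsetSum _ fun I _ => tendsto_finsetSum _ fun J _ => (hentry I J).const_mul _
  have hev : ∀ᶠ k in atTop, (∑ I, ∑ J, conj (coef I) * coef J *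
      texp r.ρ (sch.β k) true (fun U => ((A k I (swapConfig U) * A k J U : ℝ) : ℂ))) ∈ C := by
    filter_upwards [eventually_two_le_side sch, hAdep] with k hk hdep
    -- NEW: a central twist `z_k` making the cover `Θ'_{z_k}`-RP at this step; the `A k I` are blind to `C_{z_k}`
    obtain ⟨zc, hzc, hRPk⟩ := hRP k hk
    have hAz : ∀ I U, A k I (centreTwist zc U) = A k I U := fun I U =>
      Finset.prod_congr rfl fun l _ => RpClosureTwisted.coverField_centreTwist r sch k _ hzc U
    exact RpClosureTwisted.lattice_psd_twisted r (sch.β k) (sch.side k) hRPk (A k) (fun I => (hAobs k I).1)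
      (fun I => (hAobs k I).2) hdep hAz coef
  exact hCcl.mem_of_tendsto hlim hev

end PSD

/-! ## §I'' Frame reduction and the closure argument, from twisted cover RP -/

section Closure

variable {G : Type} [Group G] [TopologicalSpace G] [IsTopologicalGroup G] [CompactSpace G]
  [MeasurableSpace G] [BorelSpace G] (r : LatticeRep G) (sch : SpeciesScheme (YMSpecies G))
  (S₁ : SchwingerFamily E4)

/-- **(PSD) in every diagonal frame, twisted cover RP**: reduce `R` to a canonical frame by a proper sign flip `P` (the
package's `W(B₄)`-invariance on `⁰𝒮`: `𝔖(PR · G) = 𝔖(R · G)` for the off-diagonal `G = Θ P_I* ⊗ P_J`), then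
`psd_canonical_twisted`. -/
theorem psd_frame_twisted (hW : CurvaturePackage r sch S₁)
    (hRP : ∀ k, 2 ≤ sch.side k → ∃ z ∈ Subgroup.center G, CoverTwistedSwapRPAt r.ρ z (sch.β k) (sch.side k)) (hCI : CoverInsensitivityOffDiag r sch)
    {R : E4 ≃ₗᵢ[ℝ] E4} {a b : ℝ} (ha : a ^ 2 = 1 / 2) (hb : b ^ 2 = 1 / 2)
    (hR : R (ee 0) = a • ee 0 + b • ee 1) {ι : Type} [Fintype ι] (deg : ι → ℕ)
    (P : (I : ι) → 𝓢((Fin (deg I) → E4), ℂ)) (hP : ∀ I, P I ∈ slabOrderedCompactProducts 4 (deg I))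
    (coef : ι → ℂ) :
    let z := ∑ I, ∑ J, conj (coef I) * coef J * (pullback S₁ R).osPairing (P I) (P J)
    0 ≤ z.re ∧ z.im = 0 := by
  -- adapted from `psd_frame_offDiag` (…StubRpClosureOffDiag §I'), verbatim up to the last line
  intro z
  obtain ⟨Pf, c, hc, hc0, hdet, hsigned, hR'⟩ := frame_normal_form ha hb hR
  have hrot := hW.2.2.2.1
  have hterm : ∀ I J, (pullback S₁ R).osPairing (P I) (P J) =
      (pullback S₁ (R.trans Pf)).osPairing (P I) (P J) := by
    intro I J
    obtain ⟨fI, loI, hiI, hTI, hloI, hleI, hordI, hsuppI, -⟩ := hP I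
    obtain ⟨fJ, loJ, hiJ, hTJ, hloJ, hleJ, hordJ, hsuppJ, -⟩ := hP J
    obtain ⟨LO, HI, -, hord', hsupp'⟩ := append_slabs hloI hleI hordI hsuppI hloJ hleJ hordJ hsuppJ
    have hoff : IsOffDiagonal ((osAdjoint (P I)).appendTensor (P J)) :=
      isOffDiagonal_of_slabs (isTensorOf_osAdjoint_appendTensor hTI hTJ) hord' hsupp'
    rw [pullback_osPairing, pullback_osPairing,
      ← Summit.QuantumFields.YangMills.Theorems.DiagonalMirrorRPR.Negative.Phantom.linActMulti_linActMulti Pf R,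
      hrot Pf hdet hsigned _ _ (isOffDiagonal_linActMulti hoff R)]
  simp only [z, hterm]
  exact psd_canonical_twisted r sch S₁ hW hRP hCI hc hc0 hR' deg P hP coef

/-- **The closure step, twisted cover RP.** Twisted swap-RP upstairs (some central twist per step) + cover insensitivity on
off-diagonal families + `hconv` + E0 + continuity + the density of slab-ordered compact real products in the time-ordered
test functions ⇒ the pulled-back family is reflection positive (E2) in the diagonal frame `R`. -/
theorem isReflectionPositive_pullback_twisted (hW : CurvaturePackage r sch S₁)
    (hRP : ∀ k, 2 ≤ sch.side k → ∃ z ∈ Subgroup.center G, CoverTwistedSwapRPAt r.ρ z (sch.β k) (sch.side k)) (hCI : CoverInsensitivityOffDiag r sch)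
    {R : E4 ≃ₗᵢ[ℝ] E4} {a b : ℝ} (ha : a ^ 2 = 1 / 2) (hb : b ^ 2 = 1 / 2)
    (hR : R (ee 0) = a • ee 0 + b • ee 1) :
    (SchwingerFamily.toLabelled (fun n => (S₁ n).comp (linActMulti R))).IsReflectionPositive := by
  -- adapted from `isReflectionPositive_pullback_offDiag` (…StubRpClosureOffDiag §I'), verbatim up to `psd_frame_twisted`
  intro N deg lab F hF H hH z
  let S : SchwingerFamily E4 := pullback S₁ R
  let Φ : ((j : Fin N) → 𝓢((Fin (deg j) → E4), ℂ)) → ℂ := fun G => ∑ i, ∑ j, S.osPairing (G i) (G j)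
  have hΦ : Continuous Φ := by
    refine continuous_finsetSum _ fun i _ => continuous_finsetSum _ fun j _ => ?_
    exact continuous_iff_continuousAt.2 fun G =>
      S.tendsto_osPairing ((continuous_apply i).tendsto G) ((continuous_apply j).tendsto G)
  let C : Set ℂ := {w | 0 ≤ w.re ∧ w.im = 0}
  have hC : IsClosed C :=
    (isClosed_le continuous_const Complex.continuous_re).inter
      (isClosed_eq Complex.continuous_im continuous_const)
  let A : Set ((j : Fin N) → 𝓢((Fin (deg j) → E4), ℂ)) :=
    Set.pi Set.univ fun j => (Submodule.span ℂ (slabOrderedCompactProducts 4 (deg j)) : Set _)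
  have hA : A ⊆ Φ ⁻¹' C := by
    intro G hG
    have hrep : ∀ j : Fin N, ∃ (k : ℕ) (cf : Fin k → ℂ) (v : Fin k → slabOrderedCompactProducts 4 (deg j)),
        ∑ i, cf i • (v i : 𝓢((Fin (deg j) → E4), ℂ)) = G j :=
      fun j => Submodule.mem_span_set'.1 (hG j (Set.mem_univ j))
    choose k cf v hv using hrep
    have key := psd_frame_twisted r sch S₁ hW hRP hCI ha hb hR (ι := Σ j : Fin N, Fin (k j))
      (fun p => deg p.1) (fun p => (v p.1 p.2 : 𝓢((Fin (deg p.1) → E4), ℂ))) (fun p => (v p.1 p.2).2)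
      (fun p => cf p.1 p.2)
    have hΦG : Φ G = ∑ p : (Σ j : Fin N, Fin (k j)), ∑ q : (Σ j : Fin N, Fin (k j)),
        conj (cf p.1 p.2) * cf q.1 q.2 *
          S.osPairing (v p.1 p.2 : 𝓢((Fin (deg p.1) → E4), ℂ)) (v q.1 q.2 : 𝓢((Fin (deg q.1) → E4), ℂ)) := by
      simp only [Φ, ← hv]
      simp only [Fintype.sum_sigma]
      refine Finset.sum_congr rfl fun n _ => ?_
      rw [Finset.sum_comm]
      refine Finset.sum_congr rfl fun m _ => ?_
      have := S.osPairing_sum_smul Finset.univ Finset.univ (cf n) (cf m)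
        (fun i => (v n i : 𝓢((Fin (deg n) → E4), ℂ))) (fun i => (v m i : 𝓢((Fin (deg m) → E4), ℂ)))
      rw [this]
    show Φ G ∈ C
    rw [hΦG]
    exact key
  have hcl : closure A ⊆ Φ ⁻¹' C := (hC.preimage hΦ).closure_subset_iff.2 hA
  have hFmem : (fun j : Fin N => F j) ∈ closure A := by
    rw [closure_pi_set]
    exact fun j _ => mem_closure_span_slabOrderedCompactProducts (hF j)
  have hres : Φ (fun j => F j) ∈ C := hcl hFmem
  have hz : z = Φ (fun j => F j) := by
    simp only [z, Φ, SchwingerFamily.toLabelled_apply]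
    refine Finset.sum_congr rfl fun i _ => Finset.sum_congr rfl fun j _ => ?_
    exact S.osPairing_eq_of_isAppendTensorOf (hH i j)
  rw [hz]
  exact hres

end Closure

end RpClosureTwisted

/-! ## The registered stub -/

/-- **S4'' (M), `stub_rpClosureTwisted` — the OS-limit closure from TWISTED cover RP, no sign clause.**  Twisted swap-RP
upstairs (at each step `N_k ≥ 2` some central `z` with `Θ'_z`-RP of Wilson's measure on the 45° cover) + cover insensitivity on
off-diagonal compact real families + `hconv` (all degrees) + E0 + continuity of `S₁ n` + density of slab-ordered compact real
products in the time-ordered test functions ⇒ `DiagonalFrameRP S₁`.  The simplicity hypothesis is not used. -/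
theorem stub_rpClosureTwisted :
    ∀ (G : Type) [Group G] [TopologicalSpace G] [IsTopologicalGroup G] [CompactSpace G]
      [MeasurableSpace G] [BorelSpace G], IsCompactSimpleLieGroup G →
      ∀ (r : LatticeRep G) (sch : SpeciesScheme (YMSpecies G)) (S₁ : SchwingerFamily E4),
        CurvaturePackage r sch S₁ →
          (∀ k, 2 ≤ sch.side k → ∃ z ∈ Subgroup.center G, CoverTwistedSwapRPAt r.ρ z (sch.β k) (sch.side k)) →
            CoverInsensitivityOffDiag r sch → DiagonalFrameRP S₁ := by
  intro G _ _ _ _ _ _ _hG r sch S₁ hW hRP hCI R a b ha hb hR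
  exact RpClosureTwisted.isReflectionPositive_pullback_twisted r sch S₁ hW hRP hCI ha hb hR

end Summit.QuantumFields.YangMills.Cruxes.DiagonalMirrorRPR.CentreTwistedSwap

end
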